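import Literature.AlgebraicGeometry.Motives.HodgeLieWeightOneGradingTwo
import HarnessLib

/-!
# Weight-one Hodge structures with `dim 𝔤⁺ = dim 𝔤⁰ = 2` and `𝔷 = 0`: the root vectors `E₁, E₂`, `F₁ = Ē₁`,
# `F₂ = Ē₂` with `E₁F₂ = F₂E₁ = 0 = E₂F₁ = F₁E₂` (two commuting `𝔰𝔩₂` over `ℂ`)

Family `hodge`, layer `Literature/AlgebraicGeometry/Motives`; THEOREMS ONLY (no definition, no named fact; D-0026).
Fourth abstract file of the lane MT-RANK-SEVEN-SIMPLE of the cell `pub-hodgecm2` (COR-CM), seat `b27` gen 40; sequel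
of `Motives/HodgeLieWeightOneGradingTwo` (same setting: `H` of weight `1`, polarization `ψ`, graded basis `e` with
degrees in `{0,1}`, `P = gradingEnd e deg`, `𝔤 = 𝔥_ℂ`, `𝔤⁺ = 𝔤 ⊓ Eig₁(ad P)`, `𝔤⁻ = 𝔤 ⊓ Eig₋₁(ad P)`,
`𝔤⁰ = 𝔤 ⊓ Eig₀(ad P)`; hypotheses `𝔷 = 𝔥 ∩ End_Hdg(V) = 0` and `dim 𝔤⁺ = dim 𝔤⁰ = 2` — the `Res_{K/ℚ} SL₂`
position of `finrank_grading_of_finrank_eq_six`).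

* **`exists_rootVectors`** — THE STRUCTURE THEOREM: there are `E₁, E₂` spanning `𝔤⁺` (linearly independent) and
  their conjugates `F₁, F₂` spanning `𝔤⁻` with **`E₁F₂ = F₂E₁ = E₂F₁ = F₁E₂ = 0`**.  PROOF: put `ad Y₀` (`Y₀ ∈ 𝔤⁰`
  real, `∉ ℂ(2P−1)`, `exists_real_gradingZero`) on the plane `𝔤⁺` in Jordan form `(E₁, E₂; μ₁, μ₂, ε)`
  (`exists_jordan_pair`); conjugating, `[Y₀, F₁] = μ̄₁F₁`, `[Y₀, F₂] = εF₁ + μ̄₂F₂`; as `𝔤⁰` is abelian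
  (`gradingZero_comm`) and `[𝔤⁺, 𝔤⁻] ⊆ 𝔤⁰`, Jacobi gives `[[Y₀,E],F] + [E,[Y₀,F]] = 0`.  Hence
  `(μ₁ + μ̄₁)[E₁,F₁] = 0`, and `[E₁,F₁] ≠ 0` (else `E₁F₁ = 0`, a `P`-corner equal to a `(1−P)`-corner, against the
  second Hodge–Riemann relation `mul_conjOp_ne_zero_of_plus`), so `μ₁` is purely imaginary; a Jordan block
  (`ε = 1`) gives `[E₁,F₁] + (μ₁ + μ̄₁)[E₁,F₂] = 0`, absurd; a scalar (`ε = 0`, `μ₁ = μ₂`) makes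
  `Y₀ − (μ₁/2)(2P−1)` central in `𝔤`, so zero (`𝔷 = 0`, `eq_zero_of_mem_hodgeLieC_of_forall_commute`), i.e.
  `Y₀ ∈ ℂ(2P−1)`, absurd; so `μ₁ ≠ μ₂` are both purely imaginary and `(μ₁ + μ̄₂)[E₁,F₂] = 0` gives `[E₁,F₂] = 0`,
  whence `E₁F₂ = F₂E₁ = 0`, and symmetrically.

Classically (`Hg(ℝ) ∼ SL₂(ℝ) × SL₂(ℝ)`, `V_ℂ = (std ⊠ 1)^k ⊕ (1 ⊠ std)^k`; Moonen–Zarhin (2.3): abelian surfaces with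
real multiplication by a real quadratic field, type II(2)): the sequel `Motives/HodgeLieWeightOneGradingTwoProjectors`
builds the two complementary real idempotents `πᵢ = αᵢ⁻¹(EᵢFᵢ + FᵢEᵢ)` commuting with `𝔤`.

## References

* [Deligne1982HodgeCycles] P. Deligne, *Hodge cycles on abelian varieties*, LNM 900 (1982), I §3 (proof of Prop. 3.4,
  3.6).
* [MoonenZarhin1999LowDim] B. Moonen, Yu. Zarhin, *Hodge classes on abelian varieties of low dimension*, Math. Ann. 315
  (1999), §2 and (2.3).
* [Humphreys1972] J. E. Humphreys, *Introduction to Lie Algebras and Representation Theory*, GTM 9 (1972), §4.2, §8.1.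
* [Huybrechts2016K3] D. Huybrechts, *Lectures on K3 Surfaces* (2016), Thm. 3.3.9 (proof, p. 67).
-/

noncomputable section

open scoped TensorProduct

namespace Literature.AlgebraicGeometry.Motives

universe u

namespace HodgeStructure

open ProjectorBlocks Literature.RepresentationTheory.GeneralLinear

variable {V : Type u} [AddCommGroup V] [Module ℚ V] [Module.Finite ℚ V] [HodgeTensorFacts.{u, u}] {n : ℤ}
  {S : Type u} [Fintype S] [DecidableEq S] {deg : S → ℤ}

/-! ## §4 The root vectors -/

/-- **Root vectors when `dim 𝔤⁺ = dim 𝔤⁰ = 2` and `𝔷 = 0`.**  There are `E₁, E₂ ∈ 𝔤⁺` spanning `𝔤⁺`, linearly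
independent, with conjugates `F₁ = Ē₁, F₂ = Ē₂ ∈ 𝔤⁻` spanning `𝔤⁻`, such that
**`E₁F₂ = 0`, `F₂E₁ = 0`, `E₂F₁ = 0`, `F₁E₂ = 0`** — the complexified Hodge Lie algebra is the sum of the two commuting
triples `⟨Eᵢ, Fᵢ, [Eᵢ,Fᵢ]⟩` (two `𝔰𝔩₂` over `ℂ`; they are NOT defined over `ℚ` in the `ℚ`-simple case).  PROOF: Jordan
form of `ad Y₀` (`Y₀ ∈ 𝔤⁰` real, `∉ ℂ(2P−1)`) on the plane `𝔤⁺`; Jacobi in the abelian `𝔤⁰`; a Jordan block or a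
scalar is excluded by the second Hodge–Riemann relation (`Eᵢ Ēᵢ ≠ 0`) and by centre-freeness of `𝔤`; distinct
eigenvalues are purely imaginary and kill the cross brackets. [cite: MoonenZarhin1999LowDim, §2 and (2.3)]
[cite: Deligne1982HodgeCycles, I §3 (proof of Prop. 3.4, 3.6)] [cite: Humphreys1972, §4.2 and §8.1] -/
theorem exists_rootVectors (H : HodgeStructure V n) (ψ : H.Polarization) (hn : n = 1)
    (e : Module.Basis S ℂ (ℂ ⊗[ℚ] V)) (hF : ∀ a, H.F a = Submodule.span ℂ (e '' {σ | a ≤ deg σ}))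
    (hFc : ∀ a, complexConj (H.F a) = Submodule.span ℂ (e '' {σ | deg σ ≤ n - a}))
    (hdeg : ∀ σ, deg σ = 0 ∨ deg σ = 1) (hcenter : H.hodgeLie ⊓ Subalgebra.toSubmodule H.endAlg = ⊥)
    (hp2 : Module.finrank ℂ (H.hodgeLieC ⊓ Module.End.eigenspace
        (LinearMap.mulLeft ℂ (gradingEnd e deg) - LinearMap.mulRight ℂ (gradingEnd e deg)) 1 : Submodule ℂ _) = 2)
    (h02 : Module.finrank ℂ (H.hodgeLieC ⊓ Module.End.eigenspace
        (LinearMap.mulLeft ℂ (gradingEnd e deg) - LinearMap.mulRight ℂ (gradingEnd e deg)) 0 : Submodule ℂ _) = 2) :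
    ∃ E₁ E₂ F₁ F₂ : Module.End ℂ (ℂ ⊗[ℚ] V),
      E₁ ∈ H.hodgeLieC ∧ E₂ ∈ H.hodgeLieC ∧ F₁ ∈ H.hodgeLieC ∧ F₂ ∈ H.hodgeLieC ∧
      gradingEnd e deg * E₁ * (1 - gradingEnd e deg) = E₁ ∧ gradingEnd e deg * E₂ * (1 - gradingEnd e deg) = E₂ ∧
      (1 - gradingEnd e deg) * F₁ * gradingEnd e deg = F₁ ∧ (1 - gradingEnd e deg) * F₂ * gradingEnd e deg = F₂ ∧
      (∀ v, F₁ v = conj (E₁ (conj v))) ∧ (∀ v, F₂ v = conj (E₂ (conj v))) ∧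
      (∀ x y : ℂ, x • E₁ + y • E₂ = 0 → x = 0 ∧ y = 0) ∧
      (∀ E ∈ H.hodgeLieC, gradingEnd e deg * E * (1 - gradingEnd e deg) = E → ∃ x y : ℂ, E = x • E₁ + y • E₂) ∧
      (∀ F ∈ H.hodgeLieC, (1 - gradingEnd e deg) * F * gradingEnd e deg = F → ∃ x y : ℂ, F = x • F₁ + y • F₂) ∧
      E₁ * F₂ = 0 ∧ F₂ * E₁ = 0 ∧ E₂ * F₁ = 0 ∧ F₁ * E₂ = 0 := by
  classical
  have hPP := gradingEnd_mul_gradingEnd_of_deg e hdeg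
  set P := gradingEnd e deg with hP
  set Gp : Submodule ℂ (Module.End ℂ (ℂ ⊗[ℚ] V)) := H.hodgeLieC ⊓ Module.End.eigenspace
      (LinearMap.mulLeft ℂ P - LinearMap.mulRight ℂ P) 1 with hGp
  set G0 : Submodule ℂ (Module.End ℂ (ℂ ⊗[ℚ] V)) := H.hodgeLieC ⊓ Module.End.eigenspace
      (LinearMap.mulLeft ℂ P - LinearMap.mulRight ℂ P) 0 with hG0
  set Θ : Module.End ℂ (ℂ ⊗[ℚ] V) := (2 : ℂ) • P - 1 with hΘdef
  have hΘG : Θ ∈ G0 := theta_mem_gradingZero H hn e hF hFc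
  -- membership bookkeeping
  have memGp : ∀ {E : Module.End ℂ (ℂ ⊗[ℚ] V)}, E ∈ Gp ↔ E ∈ H.hodgeLieC ∧ P * E * (1 - P) = E := fun {E} => by
    rw [hGp, Submodule.mem_inf, mem_eigenspace_adP_one_iff hPP]
  have memG0 : ∀ {Z : Module.End ℂ (ℂ ⊗[ℚ] V)}, Z ∈ G0 ↔ Z ∈ H.hodgeLieC ∧ P * Z = Z * P := fun {Z} => by
    rw [hG0, Submodule.mem_inf, mem_eigenspace_adP_zero_iff]
  -- an ambient basis `A₁, A₂` of `𝔤⁺`; in particular `V_ℂ ≠ 0` and `Θ ≠ 0`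
  obtain ⟨A₁, A₂, hA₁, hA₂, hAind, hAspan⟩ := exists_ambient_pair hp2
  have hA₁0 : A₁ ≠ 0 := fun h => one_ne_zero (hAind 1 0 (by rw [h, smul_zero, zero_smul, add_zero])).1
  have hΘ0 : Θ ≠ 0 := by
    intro h
    have h1 : (1 : Module.End ℂ (ℂ ⊗[ℚ] V)) = 0 := by rw [← theta_mul_theta hPP, ← hΘdef, h, mul_zero]
    exact hA₁0 (by rw [← one_mul A₁, h1, zero_mul])
  -- a real `Y₀ ∈ 𝔤⁰ ∖ ℂΘ`; `𝔤⁰` is abelian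
  obtain ⟨Y₀, hY₀G, hY₀re, hY₀Θ⟩ := exists_real_gradingZero H hn e hF hFc h02
  have hcomm0 : ∀ Z ∈ G0, ∀ Z' ∈ G0, Z * Z' = Z' * Z := fun Z hZ Z' hZ' =>
    gradingZero_comm H hn e hF hFc hΘ0 h02 hZ hZ'
  obtain ⟨hY₀g, hY₀P⟩ := memG0.1 hY₀G
  -- `ad Y₀` preserves `𝔤⁺`: matrix coefficients
  have hadGp : ∀ E ∈ Gp, Y₀ * E - E * Y₀ ∈ Gp := by
    intro E hE
    obtain ⟨hEg, hE1⟩ := memGp.1 hE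
    refine memGp.2 ⟨H.commutator_mem_hodgeLieC hY₀g hEg, ?_⟩
    obtain ⟨h1, h2, -, -⟩ := zero_mul_plus (K := ℂ) (F := 0) hPP hY₀P hE1 (by rw [mul_zero, zero_mul])
    rw [mul_sub P (Y₀ * E) (E * Y₀), sub_mul, h1, h2]
  obtain ⟨a, c, hac⟩ := hAspan _ (hadGp A₁ hA₁)
  obtain ⟨b, d, hbd⟩ := hAspan _ (hadGp A₂ hA₂)
  -- Jordan form of `ad Y₀` on `𝔤⁺`
  obtain ⟨E₁, E₂, μ₁, μ₂, ε, x₁, y₁, x₂, y₂, hE₁def, hE₂def, hdet, htE₁, htE₂, hε⟩ :=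
    exists_jordan_pair (LinearMap.mulLeft ℂ Y₀ - LinearMap.mulRight ℂ Y₀) (A₁ := A₁) (A₂ := A₂)
      (a := a) (b := b) (c := c) (d := d) (by rw [adP_apply]; exact hac) (by rw [adP_apply]; exact hbd)
  rw [adP_apply] at htE₁ htE₂
  obtain ⟨hEind, hA₁E, hA₂E⟩ := basis_of_det_ne_zero hAind hE₁def hE₂def hdet
  have hE₁G : E₁ ∈ Gp := by rw [hE₁def]; exact Gp.add_mem (Gp.smul_mem _ hA₁) (Gp.smul_mem _ hA₂)
  have hE₂G : E₂ ∈ Gp := by rw [hE₂def]; exact Gp.add_mem (Gp.smul_mem _ hA₁) (Gp.smul_mem _ hA₂)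
  obtain ⟨hE₁g, hE₁⟩ := memGp.1 hE₁G
  obtain ⟨hE₂g, hE₂⟩ := memGp.1 hE₂G
  have hE₁0 : E₁ ≠ 0 := fun h => one_ne_zero (hEind 1 0 (by rw [h, smul_zero, zero_smul, add_zero])).1
  have hE₂0 : E₂ ≠ 0 := fun h => one_ne_zero (hEind 0 1 (by rw [h, smul_zero, zero_smul, zero_add])).2
  have hGpspan : ∀ E ∈ Gp, ∃ x y : ℂ, E = x • E₁ + y • E₂ := by
    intro E hE
    obtain ⟨x, y, rfl⟩ := hAspan E hE
    rw [hA₁E, hA₂E]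
    exact ⟨x * ((x₁ * y₂ - y₁ * x₂)⁻¹ * y₂) + y * (-((x₁ * y₂ - y₁ * x₂)⁻¹ * x₂)),
      x * (-((x₁ * y₂ - y₁ * x₂)⁻¹ * y₁)) + y * ((x₁ * y₂ - y₁ * x₂)⁻¹ * x₁), by module⟩
  -- the conjugates `F₁, F₂`
  obtain ⟨F₁, hF₁⟩ := exists_conjOp E₁
  obtain ⟨F₂, hF₂⟩ := exists_conjOp E₂
  have hconjg : ∀ {Y Yb : Module.End ℂ (ℂ ⊗[ℚ] V)}, Y ∈ H.hodgeLieC → (∀ v, Yb v = conj (Y (conj v))) →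
      Yb ∈ H.hodgeLieC := fun {Y Yb} hY hYb => by
    rw [hodgeLieC_eq_spanC] at hY ⊢; exact conjOp_mem_spanC hY hYb
  have hF₁g : F₁ ∈ H.hodgeLieC := hconjg hE₁g hF₁
  have hF₂g : F₂ ∈ H.hodgeLieC := hconjg hE₂g hF₂
  have hF₁m : (1 - P) * F₁ * P = F₁ := (conjOp_grading H hn e hF hFc hF₁).1 hE₁
  have hF₂m : (1 - P) * F₂ * P = F₂ := (conjOp_grading H hn e hF hFc hF₂).1 hE₂
  -- `𝔤⁻` is spanned by `F₁, F₂`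
  have hGmspan : ∀ F ∈ H.hodgeLieC, (1 - P) * F * P = F → ∃ x y : ℂ, F = x • F₁ + y • F₂ := by
    intro F hFg hFm
    obtain ⟨Fb, hFb⟩ := exists_conjOp F
    have hFbG : Fb ∈ Gp := memGp.2 ⟨hconjg hFg hFb, (conjOp_grading H hn e hF hFc hFb).2.1 hFm⟩
    obtain ⟨x, y, hxy⟩ := hGpspan Fb hFbG
    refine ⟨starRingEnd ℂ x, starRingEnd ℂ y, LinearMap.ext fun v => ?_⟩
    have h := hFb (conj v)
    rw [conj_conj] at h
    have h' : F v = conj (Fb (conj v)) := by rw [h, conj_conj]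
    rw [h', hxy, LinearMap.add_apply, LinearMap.smul_apply, LinearMap.smul_apply, map_add, conj_smul, conj_smul,
      ← hF₁, ← hF₂, LinearMap.add_apply, LinearMap.smul_apply, LinearMap.smul_apply]
  -- `ad Y₀` on `F₁, F₂` by conjugation (`Y₀` real, `ε ∈ {0,1}` real)
  have hεre : starRingEnd ℂ ε = ε := by
    rcases hε with h | ⟨h, -⟩ <;> simp [h]
  have htF₁ : Y₀ * F₁ - F₁ * Y₀ = starRingEnd ℂ μ₁ • F₁ := by
    refine LinearMap.ext fun v => ?_
    have h := congrArg (fun T : Module.End ℂ (ℂ ⊗[ℚ] V) => conj (T (conj v))) htE₁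
    simp only [LinearMap.sub_apply, map_sub, LinearMap.smul_apply, conj_smul] at h
    rw [conjOp_mul_apply hY₀re hF₁, conjOp_mul_apply hF₁ hY₀re, ← hF₁] at h
    rw [LinearMap.sub_apply, LinearMap.smul_apply]
    exact h
  have htF₂ : Y₀ * F₂ - F₂ * Y₀ = ε • F₁ + starRingEnd ℂ μ₂ • F₂ := by
    refine LinearMap.ext fun v => ?_
    have h := congrArg (fun T : Module.End ℂ (ℂ ⊗[ℚ] V) => conj (T (conj v))) htE₂
    simp only [LinearMap.sub_apply, map_sub, LinearMap.add_apply, map_add, LinearMap.smul_apply, conj_smul] at h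
    rw [conjOp_mul_apply hY₀re hF₂, conjOp_mul_apply hF₂ hY₀re, ← hF₁, ← hF₂, hεre] at h
    rw [LinearMap.sub_apply, LinearMap.add_apply, LinearMap.smul_apply, LinearMap.smul_apply]
    exact h
  -- Jacobi: `[[Y₀,E],F] + [E,[Y₀,F]] = 0` for `E ∈ 𝔤⁺`, `F ∈ 𝔤⁻` (`[E,F] ∈ 𝔤⁰` commutes with `Y₀`)
  have jacobi : ∀ {E F : Module.End ℂ (ℂ ⊗[ℚ] V)}, E ∈ H.hodgeLieC → P * E * (1 - P) = E → F ∈ H.hodgeLieC →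
      (1 - P) * F * P = F →
      (Y₀ * E - E * Y₀) * F - F * (Y₀ * E - E * Y₀) + (E * (Y₀ * F - F * Y₀) - (Y₀ * F - F * Y₀) * E) = 0 := by
    intro E F hEg hEm hFg hFm
    have hEF : E * F - F * E ∈ G0 :=
      memG0.2 ⟨H.commutator_mem_hodgeLieC hEg hFg, (mul_plus_minus_comm (K := ℂ) hPP hEm hFm).2.2.2.2.1⟩
    have h := hcomm0 _ hY₀G _ hEF
    have h' : (Y₀ * E - E * Y₀) * F - F * (Y₀ * E - E * Y₀) + (E * (Y₀ * F - F * Y₀) - (Y₀ * F - F * Y₀) * E) =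
        Y₀ * (E * F - F * E) - (E * F - F * E) * Y₀ := by
      simp only [mul_sub, sub_mul, mul_assoc]; abel
    rw [h', h, sub_self]
  -- the second Hodge–Riemann relation: `Eᵢ Fᵢ ≠ 0`
  have hHR₁ := mul_conjOp_ne_zero_of_plus H ψ hn e hF hFc hdeg hE₁g hE₁ hE₁0 hF₁
  have hHR₂ := mul_conjOp_ne_zero_of_plus H ψ hn e hF hFc hdeg hE₂g hE₂ hE₂0 hF₂
  -- `[Eᵢ, Fⱼ] = 0 ⟹ EᵢFⱼ = 0 = FⱼEᵢ`
  have kill : ∀ {E F : Module.End ℂ (ℂ ⊗[ℚ] V)}, P * E * (1 - P) = E → (1 - P) * F * P = F →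
      E * F - F * E = 0 → E * F = 0 ∧ F * E = 0 := fun {E F} hEm hFm h =>
    mul_eq_zero_of_commute_plus_minus (K := ℂ) hPP hEm hFm (sub_eq_zero.1 h)
  -- Jacobi at `(E₁, F₁)`: `(μ₁ + μ̄₁) [E₁, F₁] = 0`
  have j11 : (μ₁ + starRingEnd ℂ μ₁) • (E₁ * F₁ - F₁ * E₁) = 0 := by
    have h := jacobi hE₁g hE₁ hF₁g hF₁m
    rw [htE₁, htF₁] at h
    rw [← h]; simp only [smul_mul_assoc, mul_smul_comm, smul_sub, add_smul]; abel
  have hne11 : E₁ * F₁ - F₁ * E₁ ≠ 0 := fun h => hHR₁.1 (kill hE₁ hF₁m h).1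
  have hμ₁ : μ₁ + starRingEnd ℂ μ₁ = 0 := (smul_eq_zero.1 j11).resolve_right hne11
  -- `[Θ, E] = 2E` on `𝔤⁺`, `[Θ, F] = -2F` on `𝔤⁻`
  have hΘbr : ∀ {E F : Module.End ℂ (ℂ ⊗[ℚ] V)}, P * E * (1 - P) = E → (1 - P) * F * P = F →
      Θ * E - E * Θ = (2 : ℂ) • E ∧ Θ * F - F * Θ = -((2 : ℂ) • F) := fun {E F} hEm hFm => by
    obtain ⟨hPE, hEP, -, hPF, hFP, -⟩ := corner_identities (K := ℂ) hPP hEm hFm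
    exact theta_bracket hPE hEP hPF hFP
  -- exclude the Jordan block and the scalar case
  rcases hε with hε0 | ⟨hε1, hμ12⟩
  · subst hε0
    rw [zero_smul, zero_add] at htE₂ htF₂
    have j22 : (μ₂ + starRingEnd ℂ μ₂) • (E₂ * F₂ - F₂ * E₂) = 0 := by
      have h := jacobi hE₂g hE₂ hF₂g hF₂m
      rw [htE₂, htF₂] at h
      rw [← h]; simp only [smul_mul_assoc, mul_smul_comm, smul_sub, add_smul]; abel
    have hne22 : E₂ * F₂ - F₂ * E₂ ≠ 0 := fun h => hHR₂.1 (kill hE₂ hF₂m h).1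
    have hμ₂ : μ₂ + starRingEnd ℂ μ₂ = 0 := (smul_eq_zero.1 j22).resolve_right hne22
    have hμ₁' : starRingEnd ℂ μ₁ = -μ₁ := by rw [← sub_eq_zero, sub_neg_eq_add, add_comm]; exact hμ₁
    have hμ₂' : starRingEnd ℂ μ₂ = -μ₂ := by rw [← sub_eq_zero, sub_neg_eq_add, add_comm]; exact hμ₂
    by_cases hμ : μ₁ = μ₂
    · -- scalar case: `Y₁ = Y₀ − (μ₁/2) Θ` is central in `𝔤`, so `Y₀ ∈ ℂΘ`
      exfalso
      subst hμ
      apply hY₀Θ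
      -- `[Y₀, E] = μ₁ E` on `𝔤⁺`, `[Y₀, F] = -μ₁ F` on `𝔤⁻`
      have hbrE : ∀ E ∈ H.hodgeLieC, P * E * (1 - P) = E → Y₀ * E - E * Y₀ = μ₁ • E := by
        intro E hEg hEm
        obtain ⟨x, y, rfl⟩ := hGpspan E (memGp.2 ⟨hEg, hEm⟩)
        calc Y₀ * (x • E₁ + y • E₂) - (x • E₁ + y • E₂) * Y₀
            = x • (Y₀ * E₁ - E₁ * Y₀) + y • (Y₀ * E₂ - E₂ * Y₀) := by
              simp only [mul_add, add_mul, mul_smul_comm, smul_mul_assoc, smul_sub]; abel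
          _ = μ₁ • (x • E₁ + y • E₂) := by rw [htE₁, htE₂]; module
      have hbrF : ∀ F ∈ H.hodgeLieC, (1 - P) * F * P = F → Y₀ * F - F * Y₀ = -(μ₁ • F) := by
        intro F hFg hFm
        obtain ⟨x, y, rfl⟩ := hGmspan F hFg hFm
        calc Y₀ * (x • F₁ + y • F₂) - (x • F₁ + y • F₂) * Y₀
            = x • (Y₀ * F₁ - F₁ * Y₀) + y • (Y₀ * F₂ - F₂ * Y₀) := by
              simp only [mul_add, add_mul, mul_smul_comm, smul_mul_assoc, smul_sub]; abel
          _ = -(μ₁ • (x • F₁ + y • F₂)) := by rw [htF₁, htF₂, hμ₁']; module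
      -- `Y₁` commutes with the three pieces
      have key : ∀ T : Module.End ℂ (ℂ ⊗[ℚ] V), (Y₀ - ((2 : ℂ)⁻¹ * μ₁) • Θ) * T - T * (Y₀ - ((2 : ℂ)⁻¹ * μ₁) • Θ) =
          (Y₀ * T - T * Y₀) - ((2 : ℂ)⁻¹ * μ₁) • (Θ * T - T * Θ) := fun T => by
        rw [sub_mul, mul_sub, smul_mul_assoc, mul_smul_comm, smul_sub]; abel
      have hcE : ∀ E ∈ H.hodgeLieC, P * E * (1 - P) = E →
          (Y₀ - ((2 : ℂ)⁻¹ * μ₁) • Θ) * E - E * (Y₀ - ((2 : ℂ)⁻¹ * μ₁) • Θ) = 0 := by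
        intro E hEg hEm
        rw [key, hbrE E hEg hEm, (hΘbr hEm hF₁m).1, smul_smul]
        have h2 : (2 : ℂ)⁻¹ * μ₁ * 2 = μ₁ := by ring
        rw [h2, sub_self]
      have hcF : ∀ F ∈ H.hodgeLieC, (1 - P) * F * P = F →
          (Y₀ - ((2 : ℂ)⁻¹ * μ₁) • Θ) * F - F * (Y₀ - ((2 : ℂ)⁻¹ * μ₁) • Θ) = 0 := by
        intro F hFg hFm
        rw [key, hbrF F hFg hFm, (hΘbr hE₁ hFm).2, smul_neg, smul_smul]
        have h2 : (2 : ℂ)⁻¹ * μ₁ * 2 = μ₁ := by ring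
        rw [h2, sub_neg_eq_add, neg_add_cancel]
      have hcZ : ∀ Z ∈ G0, (Y₀ - ((2 : ℂ)⁻¹ * μ₁) • Θ) * Z - Z * (Y₀ - ((2 : ℂ)⁻¹ * μ₁) • Θ) = 0 := by
        intro Z hZ
        rw [sub_eq_zero]
        exact hcomm0 _ (G0.sub_mem hY₀G (G0.smul_mem _ hΘG)) _ hZ
      have hcent : Y₀ - ((2 : ℂ)⁻¹ * μ₁) • Θ = 0 := by
        refine eq_zero_of_mem_hodgeLieC_of_forall_commute H hcenter
          (H.hodgeLieC.sub_mem hY₀g (H.hodgeLieC.smul_mem _ hΘG.1)) fun Y hY => ?_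
        obtain ⟨gE, gF, gZ⟩ := hodgeLieC_components_mem H e hF hFc hdeg hY
        obtain ⟨c1, c2, c3, hsum⟩ := components_mem_eigenspace_adP (K := ℂ) hPP Y
        rw [mem_eigenspace_adP_one_iff hPP] at c1
        rw [mem_eigenspace_adP_neg_one_iff hPP] at c2
        rw [mem_eigenspace_adP_zero_iff] at c3
        rw [← sub_eq_zero, ← hsum]
        have hsplit : ∀ T A B C : Module.End ℂ (ℂ ⊗[ℚ] V), T * (A + B + C) - (A + B + C) * T =
            (T * A - A * T) + (T * B - B * T) + (T * C - C * T) := fun T A B C => by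
          simp only [mul_add, add_mul]; abel
        rw [hsplit, hcE _ gE c1, hcF _ gF c2, hcZ _ (memG0.2 ⟨gZ, c3⟩), add_zero, add_zero]
      rw [sub_eq_zero] at hcent
      rw [hcent]
      exact Submodule.smul_mem _ _ (Submodule.mem_span_singleton_self _)
    · -- distinct eigenvalues: the cross brackets vanish
      have j12 : (μ₁ + starRingEnd ℂ μ₂) • (E₁ * F₂ - F₂ * E₁) = 0 := by
        have h := jacobi hE₁g hE₁ hF₂g hF₂m
        rw [htE₁, htF₂] at h
        rw [← h]; simp only [smul_mul_assoc, mul_smul_comm, smul_sub, add_smul]; abel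
      have j21 : (μ₂ + starRingEnd ℂ μ₁) • (E₂ * F₁ - F₁ * E₂) = 0 := by
        have h := jacobi hE₂g hE₂ hF₁g hF₁m
        rw [htE₂, htF₁] at h
        rw [← h]; simp only [smul_mul_assoc, mul_smul_comm, smul_sub, add_smul]; abel
      have hc12 : μ₁ + starRingEnd ℂ μ₂ ≠ 0 := by rw [hμ₂', ← sub_eq_add_neg]; exact sub_ne_zero.2 hμ
      have hc21 : μ₂ + starRingEnd ℂ μ₁ ≠ 0 := by
        rw [hμ₁', ← sub_eq_add_neg]; exact sub_ne_zero.2 (Ne.symm hμ)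
      obtain ⟨k12, k12'⟩ := kill hE₁ hF₂m ((smul_eq_zero.1 j12).resolve_left hc12)
      obtain ⟨k21, k21'⟩ := kill hE₂ hF₁m ((smul_eq_zero.1 j21).resolve_left hc21)
      refine ⟨E₁, E₂, F₁, F₂, hE₁g, hE₂g, hF₁g, hF₂g, hE₁, hE₂, hF₁m, hF₂m, hF₁, hF₂, hEind, ?_, hGmspan,
        k12, k12', k21, k21'⟩
      intro E hEg hEm
      exact hGpspan E (memGp.2 ⟨hEg, hEm⟩)
  · -- Jordan block: Jacobi at `(E₁, F₂)` gives `[E₁, F₁] + (μ₁ + μ̄₂)[E₁, F₂] = 0`, so `[E₁, F₁] = 0`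
    exfalso
    subst hε1
    have j12 : (E₁ * F₁ - F₁ * E₁) + (μ₁ + starRingEnd ℂ μ₂) • (E₁ * F₂ - F₂ * E₁) = 0 := by
      have h := jacobi hE₁g hE₁ hF₂g hF₂m
      rw [htE₁, htF₂] at h
      rw [← h]; simp only [smul_mul_assoc, mul_smul_comm, smul_sub, add_smul, one_smul, mul_add, add_mul]; abel
    rw [← hμ12, hμ₁, zero_smul, add_zero] at j12
    exact hne11 j12

end HodgeStructure

end Literature.AlgebraicGeometry.Motives

end
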